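import Literature.Computability.Cryptography.HallgrenWalkParams
import Literature.Computability.Complexity.CodeFPStrings
import HarnessLib

/-!
# The compact code of Hallgren's walk table (the oracle table of the period-finding core)

Topic `Computability/Cryptography`; the table `v ↦ (label, v − ⌈N d̂⌉)` of the integer walk
(`IntWalkOps.tableI` of `hallgrenOps` with the parameters `hallgrenW` of the input `x`), written in a
COMPACT fixed-width binary code so that a table value fits the answer width `L ≥ 6n + 100` of a
unit of the period-finding family (the tree's self-delimiting codes `pairE qE intE` would be about
`24|x|` bits, too long): two fields of `|x| + 6` bits for `P, Q` and one of `3|x| + 40` bits for the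
(shifted) offset — `5|x| + 52` bits in all. Jozsa 2003, §10 Prop. 36: the function `h̃_N(v)` = (ideal,
offset) "is one-to-one within each period" is what the Fourier sampling needs; injectivity of the
code on genuine values (`tabH_inj`) transfers it. Theorem-and-definition file, no named facts.

* `fixedBits w a` (LSB-first, width `w`), `length_fixedBits`, `fixedBits_inj` (`a, b < 2ʷ`), `fixedBitsC`;
* `tabVal q x v` (the integer table value), **`tabH q x v`** (its compact code), `length_tabH`,
  **`codeFP_tabH`** (through `hallgrenSpec.codeFP_tableI`), `Genuine`, **`tabH_inj`**.

## References

* R. Jozsa, arXiv:quant-ph/0302134 (2003), §10 Prop. 36. [Jozsa2003]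
* S. Arora, B. Barak, *Computational Complexity*, CUP 2009, §1.3. [AroraBarak2009]
-/

noncomputable section

open scoped Classical

namespace Literature.Computability.Cryptography

namespace HallgrenGiantStep

open _root_.Computability Literature.Computability.Complexity Literature.Computability.Complexity.CodeFP
  Literature.Computability.Complexity.LogFP PeriodFinding HallgrenPost InfraPrimitives IntWalkOps

/-! ### Fixed-width binary fields -/

/-- The `w` low bits of `a`, least significant first. [folklore] -/
def fixedBits (w a : ℕ) : List Bool := (List.range w).map fun j => decide (a / 2 ^ j % 2 = 1)

/-- Width. [folklore] -/
@[simp] theorem length_fixedBits (w a : ℕ) : (fixedBits w a).length = w := by simp [fixedBits]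

/-- Entries are the bits. [folklore] -/
theorem getD_fixedBits {w a j : ℕ} (hj : j < w) : (fixedBits w a).getD j false = a.testBit j := by
  unfold fixedBits
  rw [List.getD_eq_getElem?_getD, List.getElem?_map, List.getElem?_range hj]
  simp [Nat.testBit_eq_decide_div_mod_eq]

/-- **Fixed-width fields are injective below `2ʷ`.** [folklore] -/
theorem fixedBits_inj {w a b : ℕ} (ha : a < 2 ^ w) (hb : b < 2 ^ w) (h : fixedBits w a = fixedBits w b) : a = b := by
  apply Nat.eq_of_testBit_eq
  intro j
  by_cases hj : j < w
  · rw [← getD_fixedBits hj, ← getD_fixedBits hj, h]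
  · push Not at hj
    have h2 : 2 ^ w ≤ 2 ^ j := Nat.pow_le_pow_right (by norm_num) hj
    rw [Nat.testBit_lt_two_pow (lt_of_lt_of_le ha h2), Nat.testBit_lt_two_pow (lt_of_lt_of_le hb h2)]

/-- **Fixed-width fields on codes**: `(1ʷ, a) ↦ fixedBits w a`. [cite: AroraBarak2009, §1.3] -/
theorem fixedBitsC : CodeFP (pairE unE natE) strE (fun p => fixedBits p.1 p.2) := by
  have hw : CodeFP (pairE unE natE) unE (fun p => p.1) := fst _ _
  have hj : CodeFP (pairE (pairE unE natE) natE) unE (fun t => min t.2 t.1.1) := (unOfNatMin.comp ((fst _ _).fst'.pair (snd _ _)) :)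
  have hpow : CodeFP (pairE (pairE unE natE) natE) natE (fun t => 2 ^ min t.2 t.1.1) := (natPow.comp ((const _ (2 : ℕ)).pair hj) :)
  have hbit : CodeFP (pairE (pairE unE natE) natE) bitE (fun t => decide (t.1.2 / 2 ^ min t.2 t.1.1 % 2 = 1)) :=
    (natEq.comp ((natMod.comp ((natDiv.comp ((fst _ _).snd'.pair hpow)).pair (const _ (2 : ℕ)))).pair (const _ (1 : ℕ))) :)
  have hlist := (mapRange hw hbit :)
  refine ((bitsToStr.comp hlist).congr fun p => ?_ :)
  show (List.range p.1).map (fun i => decide (p.2 / 2 ^ min i p.1 % 2 = 1)) = fixedBits p.1 p.2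
  unfold fixedBits
  refine List.map_congr_left fun j hj => ?_
  rw [min_eq_left (List.mem_range.1 hj).le]

/-- Three concatenated fields decode. [folklore] -/
theorem append3_inj {w₁ w₂ w₃ : ℕ} {a₁ a₂ a₃ b₁ b₂ b₃ : ℕ} (h1 : a₁ < 2 ^ w₁) (h1' : b₁ < 2 ^ w₁)
    (h2 : a₂ < 2 ^ w₂) (h2' : b₂ < 2 ^ w₂) (h3 : a₃ < 2 ^ w₃) (h3' : b₃ < 2 ^ w₃)
    (h : fixedBits w₁ a₁ ++ fixedBits w₂ a₂ ++ fixedBits w₃ a₃ = fixedBits w₁ b₁ ++ fixedBits w₂ b₂ ++ fixedBits w₃ b₃) :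
    a₁ = b₁ ∧ a₂ = b₂ ∧ a₃ = b₃ := by
  rw [List.append_assoc, List.append_assoc] at h
  obtain ⟨e1, h⟩ := List.append_inj h (by simp)
  obtain ⟨e2, e3⟩ := List.append_inj h (by simp)
  exact ⟨fixedBits_inj h1 h1' e1, fixedBits_inj h2 h2' e2, fixedBits_inj h3 h3' e3⟩

/-! ### The table value and its code -/

/-- **The integer table value of the input `x` at `v`**: label and offset of the walk to `v/N`. [cite: Jozsa2003, §10 (h̃_N)] -/
def tabVal (q : Polynomial ℕ) (x : List Bool) (v : ℕ) : (ℤ × ℤ) × ℤ :=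
  hallgrenOps.tableI ((hallgrenW q).dOf x) ((hallgrenW q).N x) ((hallgrenW q).s₀ x) ((hallgrenW q).T x) (2 * (hallgrenW q).M x) v

/-- The width of the offset field. [folklore] -/
def offW (x : List Bool) : ℕ := 3 * x.length + 40

/-- **The compact code of the table value**: `P`, `Q` in `|x| + 6` bits each, the offset shifted by
`2^{offW − 1}` in `offW = 3|x| + 40` bits. [cite: Jozsa2003, §10 Prop. 36] -/
def tabH (q : Polynomial ℕ) (x : List Bool) (v : ℕ) : List Bool :=
  fixedBits (x.length + 6) (tabVal q x v).1.1.toNat ++ fixedBits (x.length + 6) (tabVal q x v).1.2.toNat ++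
    fixedBits (offW x) ((tabVal q x v).2 + 2 ^ (offW x - 1)).toNat

/-- **The code is short**: `|tabH x v| = 5|x| + 52`. [folklore] -/
theorem length_tabH (q : Polynomial ℕ) (x : List Bool) (v : ℕ) : (tabH q x v).length = 5 * x.length + 52 := by
  simp [tabH, offW]; ring

/-- **The table code is computable**: `(x, v) ↦ tabH x v`, through the integer walk on codes
(`hallgrenSpec.codeFP_tableI`). [cite: Jozsa2003, §9 Thm. 5, §10] [cite: AroraBarak2009, §1.3] -/
theorem codeFP_tabH (q : Polynomial ℕ) : CodeFP (pairE strE natE) strE (fun p => tabH q p.1 p.2) := by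
  have hx : CodeFP (pairE strE natE) strE (fun p => p.1) := fst _ _
  have hv : CodeFP (pairE strE natE) natE (fun p => p.2) := snd _ _
  -- the context of `codeFP_tableI`: `(d, N, v, 1^{s₀}, 1^T, 1^B)`
  have hctx : CodeFP (pairE strE natE) (FPSpec.tctxE dE) (fun p => ((hallgrenW q).dOf p.1, (hallgrenW q).N p.1, (p.2 : ℤ),
      (hallgrenW q).s₀ p.1, (hallgrenW q).T p.1, 2 * (hallgrenW q).M p.1)) :=
    (((hallgrenW_dOf_fp q).comp hx).pair (((hallgrenW_N_fp q).comp hx).pair ((intOfNat.comp hv).pair (((hallgrenW_s₀_fp q).comp hx).pair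
      (((hallgrenW_T_fp q).comp hx).pair (umul' (const _ (2 : ℕ)) ((hallgrenW_M_fp q).comp hx)))))) :)
  have htab : CodeFP (pairE strE natE) (pairE qE intE) (fun p => tabVal q p.1 p.2) :=
    ((hallgrenSpec.codeFP_tableI.comp hctx).congr fun p => rfl)
  have hw1 : CodeFP (pairE strE natE) unE (fun p => p.1.length + 6) := uadd' (strLength.comp hx) (const _ (6 : ℕ))
  have hw3 : CodeFP (pairE strE natE) unE (fun p => offW p.1) :=
    (uadd' (umul' (const _ (3 : ℕ)) (strLength.comp hx)) (const _ (40 : ℕ))).congr fun _ => rfl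
  have hP : CodeFP (pairE strE natE) natE (fun p => (tabVal q p.1 p.2).1.1.toNat) := (intToNat.comp htab.fst'.fst' :)
  have hQ : CodeFP (pairE strE natE) natE (fun p => (tabVal q p.1 p.2).1.2.toNat) := (intToNat.comp htab.fst'.snd' :)
  have hoff : CodeFP (pairE strE natE) natE (fun p => ((tabVal q p.1 p.2).2 + 2 ^ (offW p.1 - 1)).toNat) := by
    have hw' : CodeFP (pairE strE natE) unE (fun p => offW p.1 - 1) :=
      (unOfNatMin.comp (hw3.pair (natSub.comp ((natOfUn.comp hw3).pair (const _ (1 : ℕ)))))).congr fun p => by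
        show min (offW p.1 - 1) (offW p.1) = offW p.1 - 1; exact min_eq_left (Nat.sub_le _ _)
    exact (intToNat.comp (intAdd.comp (htab.snd'.pair (intOfNat.comp (natPow.comp ((const _ (2 : ℕ)).pair hw'))))) :).congr
      fun p => by push_cast; rfl
  have f1 : CodeFP (pairE strE natE) strE (fun p => fixedBits (p.1.length + 6) (tabVal q p.1 p.2).1.1.toNat) := (fixedBitsC.comp (hw1.pair hP) :)
  have f2 : CodeFP (pairE strE natE) strE (fun p => fixedBits (p.1.length + 6) (tabVal q p.1 p.2).1.2.toNat) := (fixedBitsC.comp (hw1.pair hQ) :)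
  have f3 : CodeFP (pairE strE natE) strE (fun p => fixedBits (offW p.1) ((tabVal q p.1 p.2).2 + 2 ^ (offW p.1 - 1)).toNat) :=
    (fixedBitsC.comp (hw3.pair hoff) :)
  exact ((strAppend.comp ((strAppend.comp (f1.pair f2)).pair f3)).congr fun p => rfl)

/-! ### Injectivity on genuine values -/

/-- **Genuine table values**: positive label entries below `2^{|x|+5}` and an offset below
`2^{offW − 1}` in absolute value (what the walk produces on `[0, Q)`, shown at assembly). [folklore] -/
def Genuine (x : List Bool) (t : (ℤ × ℤ) × ℤ) : Prop :=
  0 ≤ t.1.1 ∧ t.1.1 < 2 ^ (x.length + 5) ∧ 0 ≤ t.1.2 ∧ t.1.2 < 2 ^ (x.length + 5) ∧ |t.2| < 2 ^ (offW x - 1)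

/-- **The compact code is one-to-one on genuine values.** [cite: Jozsa2003, §10 Prop. 36 (i)] -/
theorem tabH_inj {q : Polynomial ℕ} {x : List Bool} {v v' : ℕ} (hg : Genuine x (tabVal q x v)) (hg' : Genuine x (tabVal q x v'))
    (h : tabH q x v = tabH q x v') : tabVal q x v = tabVal q x v' := by
  obtain ⟨a0, a1, b0, b1, c1⟩ := hg
  obtain ⟨a0', a1', b0', b1', c1'⟩ := hg'
  have hW : 1 ≤ offW x := by unfold offW; omega
  have hpow : (2 : ℤ) ^ (offW x - 1) + 2 ^ (offW x - 1) = 2 ^ offW x := by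
    conv_rhs => rw [show offW x = (offW x - 1) + 1 by omega, pow_succ]
    ring
  -- ranges of the three fields, in `ℕ` through `ℤ`
  have h56 : (2 : ℤ) ^ (x.length + 5) < 2 ^ (x.length + 6) := pow_lt_pow_right₀ (by norm_num) (by omega)
  have r1 : (tabVal q x v).1.1.toNat < 2 ^ (x.length + 6) := by
    have : (((tabVal q x v).1.1.toNat : ℕ) : ℤ) < 2 ^ (x.length + 6) := by rw [Int.toNat_of_nonneg a0]; linarith
    exact_mod_cast this
  have r1' : (tabVal q x v').1.1.toNat < 2 ^ (x.length + 6) := by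
    have : (((tabVal q x v').1.1.toNat : ℕ) : ℤ) < 2 ^ (x.length + 6) := by rw [Int.toNat_of_nonneg a0']; linarith
    exact_mod_cast this
  have r2 : (tabVal q x v).1.2.toNat < 2 ^ (x.length + 6) := by
    have : (((tabVal q x v).1.2.toNat : ℕ) : ℤ) < 2 ^ (x.length + 6) := by rw [Int.toNat_of_nonneg b0]; linarith
    exact_mod_cast this
  have r2' : (tabVal q x v').1.2.toNat < 2 ^ (x.length + 6) := by
    have : (((tabVal q x v').1.2.toNat : ℕ) : ℤ) < 2 ^ (x.length + 6) := by rw [Int.toNat_of_nonneg b0']; linarith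
    exact_mod_cast this
  rw [abs_lt] at c1 c1'
  have n3 : 0 ≤ (tabVal q x v).2 + 2 ^ (offW x - 1) := by linarith
  have n3' : 0 ≤ (tabVal q x v').2 + 2 ^ (offW x - 1) := by linarith
  have r3 : ((tabVal q x v).2 + 2 ^ (offW x - 1)).toNat < 2 ^ offW x := by
    have : ((((tabVal q x v).2 + 2 ^ (offW x - 1)).toNat : ℕ) : ℤ) < 2 ^ offW x := by rw [Int.toNat_of_nonneg n3]; linarith
    exact_mod_cast this
  have r3' : ((tabVal q x v').2 + 2 ^ (offW x - 1)).toNat < 2 ^ offW x := by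
    have : ((((tabVal q x v').2 + 2 ^ (offW x - 1)).toNat : ℕ) : ℤ) < 2 ^ offW x := by rw [Int.toNat_of_nonneg n3']; linarith
    exact_mod_cast this
  obtain ⟨e1, e2, e3⟩ := append3_inj r1 r1' r2 r2' r3 r3' h
  -- undo `toNat`
  have E1 : (tabVal q x v).1.1 = (tabVal q x v').1.1 := by
    have := congrArg (Nat.cast : ℕ → ℤ) e1
    rwa [Int.toNat_of_nonneg a0, Int.toNat_of_nonneg a0'] at this
  have E2 : (tabVal q x v).1.2 = (tabVal q x v').1.2 := by
    have := congrArg (Nat.cast : ℕ → ℤ) e2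
    rwa [Int.toNat_of_nonneg b0, Int.toNat_of_nonneg b0'] at this
  have E3 : (tabVal q x v).2 = (tabVal q x v').2 := by
    have := congrArg (Nat.cast : ℕ → ℤ) e3
    rw [Int.toNat_of_nonneg n3, Int.toNat_of_nonneg n3'] at this
    linarith
  exact Prod.ext (Prod.ext E1 E2) E3

end HallgrenGiantStep

end Literature.Computability.Cryptography

end
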